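import Summits.NavierStokesRegularity.NavierStokesRegularity.Theorems.PoloidalWindowRigidity.Negative.StrainedCrossedLayersSlice
import Literature.Analysis.FluidPDE.SwirlTransportProofs
import HarnessLib

/-!
# Strained crossed suction layers — part 5: no Killing symmetry on any slice, and
# **the SUPERSEDED constant-slope form (v1) of LRC″ is false for classical flows** (`not_lrcForClassicalFlows`)
# (negative lemma for crux `PoloidalWindowRigidity`, K2, 19708; line `lrc-jet`)

Theorems/…/Negative proofs file, concluding the (TV) certificate (parts 1–4: `ExpTriadWave`,
`ExpTriadLinearFlow`, `StrainedCrossedLayers`, `StrainedCrossedLayersSlice`).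

* `exists_translation_defect` (`a, b, c ≠ 0 ≠ s`): on every slice, every direction `e ≠ 0`, every non-empty
  open `U`: `∂_e ω ≠ 0` somewhere in `U`;  `exists_rotation_defect` (`c ≠ 0`): `Jω ≠ Dω[J(y − q)]` somewhere in
  `U`, for every vertical axis through `q`.  (Direct shift arguments along `e₀`, `e₁` with the factor
  `e^{ατ} ≠ 1`; only vertical rotations are needed because the conclusions of the `lrc-jet` stubs name only those.)
* `LrcForClassicalFlows` := the SUPERSEDED v1 form of the local-rigidity stub (skeleton `lrc_jet.lean` as registered
  before 09:49Z on 2026-08-27, stub then named `stub_lrc`: shear slope pinned only to be «not locally CONSTANT»,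
  `∀ μ : ℝ, …`) with the CLASS hypotheses `HasTypeITimeDecay C v` + mild/Duhamel identity replaced by «classical NS
  flow on `ℝ × ℝ³`», all other binders verbatim; `not_lrcForClassicalFlows : ¬ LrcForClassicalFlows`, witnessed by
  `strainedField 1 1 1 1` on the full window `W = (−∞, 0) × ℝ³`.

READING, relative to the CURRENTLY registered skeleton (v2 09:49Z → v3 11:03Z, single open stub `stub_lrcModEntire`;
v2's `stub_lrcSpatial` is now derived from it): the v1 constant-slope form fails for classical flows (this file).  The
registered stubs quantify the slope pin over FUNCTIONS of time (`∀ m : ℝ → ℝ, ∀ open nonempty W₁ ⊆ W, ∃ z ∈ W₁, ∃ b ≠ 2,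
∂₂v_b(z) ≠ m(z.1) ∂_b v₂(z)`), and the witness's shear ratio `−s² e^{−6t}` (`StrainedCrossedLayersSlice`) IS a function
of time alone, so the witness does NOT satisfy their hypothesis (v2/v3 docstrings say so: «refuter1's (TV) witness …
thereby excluded»); moreover it is an entire field unbounded on `ℝ³`, i.e. it falls under v3's third alternative.  The
remaining question for `stub_lrcModEntire` is untouched by this file.
WHAT THIS IS NOT: not a statement about Navier–Stokes regularity or blow-up; no registered stub and no Theses
declaration is refuted here (the witness is unbounded, infinite energy, not ancient-mild in `𝔓(C)`).
Sources of the witness family: strained (Burgers-type) suction layers [cite: Drazin2002, Ex. 8.27 p. 151];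
exact Kelvin-mode / linear-flow superpositions [cite: CraikCriminale1986]. [folklore]
-/

noncomputable section

open Set Function Filter InnerProductSpace WithLp
open scoped ContDiff InnerProductSpace RealInnerProductSpace InnerProduct Topology

-- the summit and its single sub-problem share the name (CONVENTIONS §1)
set_option linter.dupNamespace false

/-! ## No Killing symmetry on any slice; LRC″ is false for classical flows outside the class -/

namespace Summit.NavierStokesRegularity.NavierStokesRegularity.Theorems.PoloidalWindowRigidity.Negative.StrainedLayers

open Real Literature.Analysis.FluidPDE Literature.Analysis.FluidPDE.KelvinMode
open Summit.NavierStokesRegularity.NavierStokesRegularity.Theorems.PoloidalWindowRigidity.Negative.ExpTriad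

/-- Local notation for physical space `ℝ³ = EuclideanSpace ℝ (Fin 3)`. -/
local notation "ℝ³" => EuclideanSpace ℝ (Fin 3)
/-- Local notation for the standard basis vectors. -/
local notation "𝐞" j => EuclideanSpace.single (j : Fin 3) (1 : ℝ)

variable (s a b c : ℝ)

/-! ### §10 Shifts of the layers along `e₀` and `e₁` -/

/-- `E₁(y + τe₀) = e^{ατ} E₁(y)`. [folklore] -/
theorem E₁_add_smul_single_zero (t τ : ℝ) (y : ℝ³) :
    E₁ s t (y + τ • (𝐞 0)) = exp (α t * τ) * E₁ s t y := by
  simp [E₁, ← exp_add]; ring_nf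
/-- `E₂(y + τe₀) = e^{−ατ} E₂(y)`. [folklore] -/
theorem E₂_add_smul_single_zero (t τ : ℝ) (y : ℝ³) :
    E₂ s t (y + τ • (𝐞 0)) = (exp (α t * τ))⁻¹ * E₂ s t y := by
  simp [E₂, ← exp_neg, ← exp_add]; ring_nf
/-- `E₃(y + τe₀) = E₃(y)`. [folklore] -/
theorem E₃_add_smul_single_zero (t τ : ℝ) (y : ℝ³) : E₃ s t (y + τ • (𝐞 0)) = E₃ s t y := by
  simp [E₃]
/-- `E₁(y + τe₁) = E₁(y)`. [folklore] -/
theorem E₁_add_smul_single_one (t τ : ℝ) (y : ℝ³) : E₁ s t (y + τ • (𝐞 1)) = E₁ s t y := by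
  simp [E₁]
/-- `E₂(y + τe₁) = E₂(y)`. [folklore] -/
theorem E₂_add_smul_single_one (t τ : ℝ) (y : ℝ³) : E₂ s t (y + τ • (𝐞 1)) = E₂ s t y := by
  simp [E₂]
/-- `E₃(y + τe₁) = e^{ατ} E₃(y)`. [folklore] -/
theorem E₃_add_smul_single_one (t τ : ℝ) (y : ℝ³) :
    E₃ s t (y + τ • (𝐞 1)) = exp (α t * τ) * E₃ s t y := by
  simp [E₃, ← exp_add]; ring_nf

/-! ### §11 The vorticity gradient of a slice -/

/-- The covector `α dx₀ + σ dx₂` of the first layer. [folklore] -/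
def ℓ₁ (s t : ℝ) : ℝ³ →L[ℝ] ℝ :=
  α t • (EuclideanSpace.proj 0 : ℝ³ →L[ℝ] ℝ) + σ s t • (EuclideanSpace.proj 2 : ℝ³ →L[ℝ] ℝ)
/-- The covector `−α dx₀ + σ dx₂` of the second layer. [folklore] -/
def ℓ₂ (s t : ℝ) : ℝ³ →L[ℝ] ℝ :=
  -(α t • (EuclideanSpace.proj 0 : ℝ³ →L[ℝ] ℝ)) + σ s t • (EuclideanSpace.proj 2 : ℝ³ →L[ℝ] ℝ)
/-- The covector `α dx₁ − σ dx₂` of the third layer. [folklore] -/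
def ℓ₃ (s t : ℝ) : ℝ³ →L[ℝ] ℝ :=
  α t • (EuclideanSpace.proj 1 : ℝ³ →L[ℝ] ℝ) - σ s t • (EuclideanSpace.proj 2 : ℝ³ →L[ℝ] ℝ)

/-- `ℓ₁ h = αh₀ + σh₂`. [folklore] -/
@[simp] theorem ℓ₁_apply (t : ℝ) (h : ℝ³) : ℓ₁ s t h = α t * h 0 + σ s t * h 2 := rfl
/-- `ℓ₂ h = −αh₀ + σh₂`. [folklore] -/
@[simp] theorem ℓ₂_apply (t : ℝ) (h : ℝ³) : ℓ₂ s t h = -(α t * h 0) + σ s t * h 2 := rfl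
/-- `ℓ₃ h = αh₁ − σh₂`. [folklore] -/
@[simp] theorem ℓ₃_apply (t : ℝ) (h : ℝ³) : ℓ₃ s t h = α t * h 1 - σ s t * h 2 := rfl

/-- `DE₁ = E₁ ℓ₁`. [folklore] -/
theorem hasFDerivAt_E₁ (t : ℝ) (y : ℝ³) : HasFDerivAt (E₁ s t) (E₁ s t y • ℓ₁ s t) y := by
  have e : E₁ s t = fun y => exp (ℓ₁ s t y) := funext fun y => by simp [E₁]
  rw [e]; exact (ℓ₁ s t).hasFDerivAt.exp
/-- `DE₂ = E₂ ℓ₂`. [folklore] -/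
theorem hasFDerivAt_E₂ (t : ℝ) (y : ℝ³) : HasFDerivAt (E₂ s t) (E₂ s t y • ℓ₂ s t) y := by
  have e : E₂ s t = fun y => exp (ℓ₂ s t y) := funext fun y => by simp [E₂]
  rw [e]; exact (ℓ₂ s t).hasFDerivAt.exp
/-- `DE₃ = E₃ ℓ₃`. [folklore] -/
theorem hasFDerivAt_E₃ (t : ℝ) (y : ℝ³) : HasFDerivAt (E₃ s t) (E₃ s t y • ℓ₃ s t) y := by
  have e : E₃ s t = fun y => exp (ℓ₃ s t y) := funext fun y => by simp [E₃]
  rw [e]; exact (ℓ₃ s t).hasFDerivAt.exp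

/-- The slice vorticity as a combination of the standard basis vectors. [folklore] -/
theorem vort_eq (t : ℝ) (y : ℝ³) : vort s a b c t y =
    (c * G s t * (α t ^ 2 + σ s t ^ 2) * E₃ s t y) • (𝐞 0) +
      (G s t * (α t ^ 2 + σ s t ^ 2) * (b * E₂ s t y - a * E₁ s t y)) • (𝐞 1) := by
  ext i; fin_cases i <;> simp [vort]

/-- The derivative of the slice vorticity. [folklore] -/
theorem hasFDerivAt_vort (t : ℝ) (y : ℝ³) : HasFDerivAt (vort s a b c t)
    (((c * G s t * (α t ^ 2 + σ s t ^ 2) * E₃ s t y) • ℓ₃ s t).smulRight (𝐞 0) +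
      ((G s t * (α t ^ 2 + σ s t ^ 2)) •
        ((b * E₂ s t y) • ℓ₂ s t - (a * E₁ s t y) • ℓ₁ s t)).smulRight (𝐞 1)) y := by
  have e : vort s a b c t = fun y => (c * G s t * (α t ^ 2 + σ s t ^ 2) * E₃ s t y) • (𝐞 0) +
      (G s t * (α t ^ 2 + σ s t ^ 2) * (b * E₂ s t y - a * E₁ s t y)) • (𝐞 1) :=
    funext (vort_eq s a b c t)
  rw [e]
  have h0 := ((hasFDerivAt_E₃ s t y).const_mul (c * G s t * (α t ^ 2 + σ s t ^ 2))).smul_const (𝐞 0)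
  have h1 := ((((hasFDerivAt_E₂ s t y).const_mul b).sub ((hasFDerivAt_E₁ s t y).const_mul a)).const_mul
    (G s t * (α t ^ 2 + σ s t ^ 2))).smul_const (𝐞 1)
  refine (h0.add h1).congr_fderiv ?_
  ext h i
  fin_cases i
  · simp [smul_smul]
  · simp [smul_smul]
  · simp [smul_smul]

/-- `(Dω(y)h)₀ = cG(α²+σ²)E₃(y)(αh₁ − σh₂)`. [folklore] -/
theorem fderiv_curl_strainedField_apply_zero (t : ℝ) (y h : ℝ³) :
    fderiv ℝ (curl (strainedField s a b c t)) y h 0 =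
      c * G s t * (α t ^ 2 + σ s t ^ 2) * E₃ s t y * (α t * h 1 - σ s t * h 2) := by
  rw [curl_strainedField_eq, (hasFDerivAt_vort s a b c t y).fderiv]; simp

/-- `(Dω(y)h)₁ = G(α²+σ²)(bE₂(y)(−αh₀ + σh₂) − aE₁(y)(αh₀ + σh₂))`. [folklore] -/
theorem fderiv_curl_strainedField_apply_one (t : ℝ) (y h : ℝ³) :
    fderiv ℝ (curl (strainedField s a b c t)) y h 1 = G s t * (α t ^ 2 + σ s t ^ 2) *
      (b * E₂ s t y * (-(α t * h 0) + σ s t * h 2) - a * E₁ s t y * (α t * h 0 + σ s t * h 2)) := by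
  rw [curl_strainedField_eq, (hasFDerivAt_vort s a b c t y).fderiv]; simp

/-- `(Dω(y)h)₂ = 0`. [folklore] -/
theorem fderiv_curl_strainedField_apply_two (t : ℝ) (y h : ℝ³) :
    fderiv ℝ (curl (strainedField s a b c t)) y h 2 = 0 := by
  rw [curl_strainedField_eq, (hasFDerivAt_vort s a b c t y).fderiv]; simp

/-! ### §12 No continuous symmetry of the slice vorticity on any open set -/

/-- Component bookkeeping for the shifts. [folklore] -/
private theorem smul_single_zero_apply_zero (τ : ℝ) : (τ • (𝐞 0) : ℝ³) 0 = τ := by simp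
/-- Component bookkeeping for the shifts. [folklore] -/
private theorem smul_single_zero_apply_one (τ : ℝ) : (τ • (𝐞 0) : ℝ³) 1 = 0 := by simp
/-- Component bookkeeping for the shifts. [folklore] -/
private theorem smul_single_zero_apply_two (τ : ℝ) : (τ • (𝐞 0) : ℝ³) 2 = 0 := by simp
/-- Component bookkeeping for the shifts. [folklore] -/
private theorem smul_single_one_apply_zero (τ : ℝ) : (τ • (𝐞 1) : ℝ³) 0 = 0 := by simp
/-- Component bookkeeping for the shifts. [folklore] -/
private theorem smul_single_one_apply_one (τ : ℝ) : (τ • (𝐞 1) : ℝ³) 1 = τ := by simp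
/-- Component bookkeeping for the shifts. [folklore] -/
private theorem smul_single_one_apply_two (τ : ℝ) : (τ • (𝐞 1) : ℝ³) 2 = 0 := by simp

/-- Three nearby shifted points of an open set. [folklore] -/
private theorem shifted_mem {U : Set ℝ³} (hU : IsOpen U) {y : ℝ³} (hy : y ∈ U) :
    ∃ τ : ℝ, 0 < τ ∧ y + τ • (𝐞 0) ∈ U ∧ y + τ • (𝐞 1) ∈ U ∧ y + τ • (𝐞 0) + τ • (𝐞 1) ∈ U := by
  obtain ⟨ε, hε, hball⟩ := Metric.isOpen_iff.mp hU y hy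
  set τ : ℝ := ε / 3 with hτ
  have hτ0 : 0 < τ := by positivity
  have hnorm : ∀ j : Fin 3, ‖τ • (𝐞 j)‖ = τ := fun j => by
    simp [norm_smul, Real.norm_of_nonneg hτ0.le]
  refine ⟨τ, hτ0, hball ?_, hball ?_, hball ?_⟩
  · rw [Metric.mem_ball, dist_eq_norm, add_sub_cancel_left, hnorm]; linarith
  · rw [Metric.mem_ball, dist_eq_norm, add_sub_cancel_left, hnorm]; linarith
  · rw [Metric.mem_ball, dist_eq_norm, add_assoc, add_sub_cancel_left]
    calc ‖τ • (𝐞 0) + τ • (𝐞 1)‖ ≤ ‖τ • (𝐞 0)‖ + ‖τ • (𝐞 1)‖ := norm_add_le _ _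
      _ = τ + τ := by rw [hnorm, hnorm]
      _ < ε := by linarith

/-- **No translation symmetry, locally** (for `a, b, c ≠ 0`, `s ≠ 0`): on every slice, for every direction
`e ≠ 0` and every non-empty open `U`, `∂_e ω ≠ 0` somewhere in `U` — the negation of the translation-germ disjunct
shared by the conclusions of the `lrc-jet` stubs (v1 `stub_lrc`, v2 `stub_lrcSpatial`, v3 `stub_lrcModEntire`).
[folklore] -/
theorem exists_translation_defect (ha : a ≠ 0) (hb : b ≠ 0) (hc : c ≠ 0) (hs : s ≠ 0) (t : ℝ) {e : ℝ³}
    (he : e ≠ 0) {U : Set ℝ³} (hU : IsOpen U) (hne : U.Nonempty) :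
    ∃ y ∈ U, fderiv ℝ (curl (strainedField s a b c t)) y e ≠ 0 := by
  by_contra hcon
  push Not at hcon
  obtain ⟨y, hy⟩ := hne
  obtain ⟨τ, hτ, m0, -, -⟩ := shifted_mem hU hy
  have H : ∀ z ∈ U, ∀ i : Fin 3, fderiv ℝ (curl (strainedField s a b c t)) z e i = 0 :=
    fun z hz i => by rw [hcon z hz]; rfl
  have A0 := H y hy 0
  have A1 := H y hy 1
  have B1 := H _ m0 1
  simp only [fderiv_curl_strainedField_apply_zero, fderiv_curl_strainedField_apply_one,
    E₁_add_smul_single_zero, E₂_add_smul_single_zero] at A0 A1 B1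
  set X : ℝ := exp (α t * τ) with hX
  have hX0 : 0 < X := exp_pos _
  have hX1 : X ≠ 1 := by rw [hX, ne_eq, exp_eq_one_iff]; exact mul_ne_zero (α_ne_zero t) hτ.ne'
  have hX2 : 1 - X ^ 2 ≠ 0 := by
    intro h
    have : X ^ 2 = 1 := by linarith
    exact hX1 ((pow_eq_one_iff_of_nonneg hX0.le two_ne_zero).mp this)
  have hG : G s t ≠ 0 := (G_pos s t).ne'
  have hn : α t ^ 2 + σ s t ^ 2 ≠ 0 := (normSq_pos s t).ne'
  have hE1 : E₁ s t y ≠ 0 := (E₁_pos s t y).ne'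
  have hE2 : E₂ s t y ≠ 0 := (E₂_pos s t y).ne'
  have hE3 : E₃ s t y ≠ 0 := (E₃_pos s t y).ne'
  have hXX : X⁻¹ * X = 1 := inv_mul_cancel₀ hX0.ne'
  -- `P = −αe₀ + σe₂`, `Q = αe₀ + σe₂`:  `bE₂P = aE₁Q` at `y`, `bX⁻¹E₂P = aXE₁Q` at `y + τe₀`
  have A1' : b * E₂ s t y * (-(α t * e 0) + σ s t * e 2) - a * E₁ s t y * (α t * e 0 + σ s t * e 2) = 0 := by
    rcases mul_eq_zero.mp A1 with h | h
    · exact absurd h (mul_ne_zero hG hn)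
    · exact h
  have B1' : b * (X⁻¹ * E₂ s t y) * (-(α t * e 0) + σ s t * e 2) -
      a * (X * E₁ s t y) * (α t * e 0 + σ s t * e 2) = 0 := by
    rcases mul_eq_zero.mp B1 with h | h
    · exact absurd h (mul_ne_zero hG hn)
    · exact h
  have hQ0 : a * E₁ s t y * (α t * e 0 + σ s t * e 2) * (1 - X ^ 2) = 0 := by
    linear_combination X * B1' - A1' -
      (b * E₂ s t y * (-(α t * e 0) + σ s t * e 2)) * hXX
  have hQ : α t * e 0 + σ s t * e 2 = 0 := by
    rcases mul_eq_zero.mp hQ0 with h | h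
    · rcases mul_eq_zero.mp h with h' | h'
      · exact absurd h' (mul_ne_zero ha hE1)
      · exact h'
    · exact absurd h hX2
  have hP : -(α t * e 0) + σ s t * e 2 = 0 := by
    have h : b * E₂ s t y * (-(α t * e 0) + σ s t * e 2) = 0 := by
      linear_combination A1' + (a * E₁ s t y) * hQ
    rcases mul_eq_zero.mp h with h' | h'
    · exact absurd h' (mul_ne_zero hb hE2)
    · exact h'
  have hR : α t * e 1 - σ s t * e 2 = 0 := by
    rcases mul_eq_zero.mp A0 with h | h
    · exact absurd h (mul_ne_zero (mul_ne_zero (mul_ne_zero hc hG) hn) hE3)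
    · exact h
  have he0 : e 0 = 0 := by
    have h : α t * e 0 = 0 := by linear_combination (hQ - hP) / 2
    exact (mul_eq_zero.mp h).resolve_left (α_ne_zero t)
  have he2 : e 2 = 0 := by
    have h : σ s t * e 2 = 0 := by linear_combination (hQ + hP) / 2
    exact (mul_eq_zero.mp h).resolve_left (σ_ne_zero hs t)
  have he1 : e 1 = 0 := by
    have h : α t * e 1 = 0 := by linear_combination hR + (σ s t) * he2
    exact (mul_eq_zero.mp h).resolve_left (α_ne_zero t)
  exact he (by ext i; fin_cases i <;> simp [he0, he1, he2])

/-- **No vertical-rotation symmetry, locally** (for `c ≠ 0`): on every slice, for every vertical axis `{y_h = q_h}`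
and every non-empty open `U`, `J ω ≠ Dω[J(y − q)]` somewhere in `U` — the negation of the rotation-germ disjunct
shared by the conclusions of the `lrc-jet` stubs (v1/v2/v3). [folklore] -/
theorem exists_rotation_defect (hc : c ≠ 0) (t : ℝ) (q : ℝ³) {U : Set ℝ³} (hU : IsOpen U)
    (hne : U.Nonempty) :
    ∃ y ∈ U, rotGen (curl (strainedField s a b c t) y) ≠
      fderiv ℝ (curl (strainedField s a b c t)) y (rotGen (y - q)) := by
  by_contra hcon
  push Not at hcon
  obtain ⟨y, hy⟩ := hne
  obtain ⟨τ, hτ, m0, m1, m01⟩ := shifted_mem hU hy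
  have H : ∀ z ∈ U, rotGen (curl (strainedField s a b c t) z) 0 =
      fderiv ℝ (curl (strainedField s a b c t)) z (rotGen (z - q)) 0 := fun z hz => by rw [hcon z hz]
  have A0 := H y hy
  have B0 := H _ m1
  have C0 := H _ m0
  have D0 := H _ m01
  simp only [rotGen_apply_zero, rotGen_apply_one, rotGen_apply_two, curl_strainedField, vort_apply_one,
    fderiv_curl_strainedField_apply_zero, PiLp.sub_apply, PiLp.add_apply,
    E₁_add_smul_single_zero, E₂_add_smul_single_zero, E₃_add_smul_single_zero, E₁_add_smul_single_one,
    E₂_add_smul_single_one, E₃_add_smul_single_one, smul_single_zero_apply_zero,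
    smul_single_one_apply_zero] at A0 B0 C0 D0
  set X : ℝ := exp (α t * τ) with hX
  have hX1 : X - 1 ≠ 0 := by
    rw [sub_ne_zero, hX, ne_eq, exp_eq_one_iff]; exact mul_ne_zero (α_ne_zero t) hτ.ne'
  have hK : c * G s t * (α t ^ 2 + σ s t ^ 2) * E₃ s t y * α t ≠ 0 :=
    mul_ne_zero (mul_ne_zero (mul_ne_zero (mul_ne_zero hc (G_pos s t).ne') (normSq_pos s t).ne')
      (E₃_pos s t y).ne') (α_ne_zero t)
  have h1 : c * G s t * (α t ^ 2 + σ s t ^ 2) * E₃ s t y * α t * ((y 0 - q 0) * (X - 1)) = 0 := by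
    linear_combination A0 - B0
  have h2 : c * G s t * (α t ^ 2 + σ s t ^ 2) * E₃ s t y * α t * ((y 0 + τ - q 0) * (X - 1)) = 0 := by
    linear_combination C0 - D0
  have e1 : y 0 - q 0 = 0 :=
    (mul_eq_zero.mp ((mul_eq_zero.mp h1).resolve_left hK)).resolve_right hX1
  have e2 : y 0 + τ - q 0 = 0 :=
    (mul_eq_zero.mp ((mul_eq_zero.mp h2).resolve_left hK)).resolve_right hX1
  exact hτ.ne' (by linarith)

/-! ### §13 The superseded constant-slope form of LRC″ is false for classical flows -/

/-- **LRC″, constant-slope form, for classical flows** — the statement of the SUPERSEDED v1 stub (`stub_lrc` of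
`Cruxes/PoloidalWindowRigidity/Lines/lrc_jet.lean` as registered before 2026-08-27T09:49Z; the skeleton registered
since — v2, then v3 — has no `stub_lrc`, its stub `stub_lrcSpatial` / `stub_lrcModEntire` pins the slope against every
FUNCTION of time `m : ℝ → ℝ`, not against constants `μ : ℝ` as here) with its two CLASS hypotheses (Type-I time decay
`HasTypeITimeDecay C v` and the mild/Duhamel identity) REPLACED by «`(v, p)` is a classical Navier–Stokes flow on all
of `ℝ × ℝ³` (viscosity `1`, no force)»; every other v1 hypothesis and the v1 conclusion verbatim.  It is FALSE
(`not_lrcForClassicalFlows`).  The witness does not satisfy the `∀ m : ℝ → ℝ` hypothesis of the registered stubs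
(its shear ratio is a function of time alone), so nothing is claimed about them. [folklore] -/
def LrcForClassicalFlows : Prop :=
  ∀ (v : ℝ → ℝ³ → ℝ³) (p : ℝ → ℝ³ → ℝ),
    IsClassicalNSSolutionOn Set.univ 1 0 v p →
    ContinuousOn (Function.uncurry v) (Set.Iio (0 : ℝ) ×ˢ Set.univ) →
    (∀ t < 0, VectorCalculus.IsDivFree (v t)) →
    (∀ s < 0, ∀ y, ⟪curl (v s) y, EuclideanSpace.single 2 1⟫_ℝ = 0) →
    ∀ W : Set (ℝ × ℝ³), IsOpen W → W.Nonempty → W ⊆ Set.Iio (0 : ℝ) ×ˢ Set.univ →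
      (∀ z ∈ W, curl (v z.1) z.2 ≠ 0 ∧
        (fderiv ℝ (v z.1) z.2 (EuclideanSpace.single 0 1) 2 ≠ 0 ∨
          fderiv ℝ (v z.1) z.2 (EuclideanSpace.single 1 1) 2 ≠ 0) ∧
        (fderiv ℝ (v z.1) z.2 (EuclideanSpace.single 2 1) 0 ≠ 0 ∨
          fderiv ℝ (v z.1) z.2 (EuclideanSpace.single 2 1) 1 ≠ 0)) →
      (∀ μ : ℝ, ∀ W₁ : Set (ℝ × ℝ³), W₁ ⊆ W → IsOpen W₁ → W₁.Nonempty →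
        ∃ z ∈ W₁, ∃ b : Fin 3, b ≠ 2 ∧
          fderiv ℝ (v z.1) z.2 (EuclideanSpace.single 2 1) b ≠
            μ * fderiv ℝ (v z.1) z.2 (EuclideanSpace.single b 1) 2) →
      ∃ s : ℝ, s < 0 ∧ ∃ U : Set ℝ³, IsOpen U ∧ U.Nonempty ∧
        ((∃ e : ℝ³, e ≠ 0 ∧ ∀ y ∈ U, fderiv ℝ (curl (v s)) y e = 0) ∨
          (∃ c : ℝ³, ∀ y ∈ U, rotGen (curl (v s) y) = fderiv ℝ (curl (v s)) y (rotGen (y - c))))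

/-- **The constant-slope form of LRC″ is false outside the class**: the strained crossed suction layers
(`s = a = b = c = 1`) satisfy every structural hypothesis of the superseded v1 stub — classical NS flow on `ℝ × ℝ³`,
continuous, divergence free, poloidal, non-degenerate on the whole window `W = (−∞,0) × ℝ³`, shear ratio
`μ(t) = −e^{−6t}` nowhere locally constant — and violate its conclusion on every slice and every open set (no
translation and no vertical-rotation symmetry of the vorticity).  Hence the v1 (constant-slope) local rigidity cannot
be proved from the local PDE structure alone: there the Type-I decay class / mild formulation is load-bearing.  The
registered v2/v3 stubs EXCLUDE this witness by their `∀ m : ℝ → ℝ` slope pin (and v3 files it under «entire,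
unbounded»); they are not addressed here.  (Unbounded witness: NOT in `𝔓(C)`.) [folklore] -/
theorem not_lrcForClassicalFlows : ¬ LrcForClassicalFlows := by
  intro h
  have sol := isClassicalNSSolutionOn_strainedField 1 1 1 1
  have hcont : ContinuousOn (Function.uncurry (strainedField 1 1 1 1)) (Set.Iio (0 : ℝ) ×ˢ Set.univ) :=
    sol.smooth_velocity.continuousOn.mono (Set.prod_mono (Set.subset_univ _) le_rfl)
  obtain ⟨t, -, U, hU, hne, hTR⟩ := h (strainedField 1 1 1 1) (strainedPressure 1 1 1 1) sol hcont
    (fun t _ => sol.divFree t (Set.mem_univ t)) (fun t _ y => inner_curl_strainedField_single_two 1 1 1 1 t y)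
    (Set.Iio 0 ×ˢ Set.univ) (isOpen_Iio.prod isOpen_univ) ⟨(-1, 0), by simp⟩ subset_rfl
    (fun z _ => nondegenerate_strainedField 1 1 1 1 one_ne_zero one_ne_zero z.1 z.2)
    (fun μ W₁ _ hW₁ hne₁ => shear_ratio_not_locally_constant 1 1 1 1 one_ne_zero one_ne_zero μ W₁ hW₁ hne₁)
  rcases hTR with ⟨e, he, hT⟩ | ⟨q, hR⟩
  · obtain ⟨y, hy, hy'⟩ :=
      exists_translation_defect 1 1 1 1 one_ne_zero one_ne_zero one_ne_zero one_ne_zero t he hU hne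
    exact hy' (hT y hy)
  · obtain ⟨y, hy, hy'⟩ := exists_rotation_defect 1 1 1 1 one_ne_zero t q hU hne
    exact hy' (hR y hy)

end Summit.NavierStokesRegularity.NavierStokesRegularity.Theorems.PoloidalWindowRigidity.Negative.StrainedLayers
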